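import Literature.AlgebraicGeometry.Resolution.OrdinaryDoublePointReduced
import Literature.AlgebraicGeometry.Resolution.AlterationsDescentStage
import Literature.AlgebraicGeometry.Resolution.RegularLocalRingsProofs
import Mathlib.AlgebraicGeometry.Geometrically.Reduced
import Mathlib.RingTheory.LocalProperties.Reduced
import Mathlib.FieldTheory.IsAlgClosed.AlgebraicClosure
import HarnessLib

/-!
# The fibres of a semi-stable curve are reduced (de Jong 1996, 2.21)

Topic: `Literature/AlgebraicGeometry/Resolution`. API for the semi-stable curves over a base of
`AlterationsSemiStable.lean` (`IsSemiStableCurve f`, de Jong 1996, 2.21: "a flat proper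
`f : X → S` of finite presentation, such that all geometric fibres are connected curves having
at most ordinary double points as singularities"; rendered there through the closed points of
the geometric fibres: regular of dimension one, or an ordinary double point,
`𝒪̂ ≅ K⟦u, v⟧/(uv)`). The fibres of such an `f` are REDUCED curves — the word "curves" of 2.21,
and the input of the normality remark of 3.4 ("`codim(Sing(X), X) ≥ 2` … by noting that `X` is
normal", `DeJong1996SemiStableSingCodimTwo` of `AlterationsSemiStableCodimTwo.lean`): all proved.

* `IsSemiStableCurve.isReduced_stalk_pullback_of_isClosed` — the local rings of a geometric
  fibre at its closed points are reduced (a regular local ring is a domain; the local ring of an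
  ordinary double point is reduced, `IsOrdinaryDoublePoint.isReduced`);
* `IsSemiStableCurve.isReduced_pullback_of_isAlgClosed` — **a geometric fibre `X ×_S Spec K`,
  `K` algebraically closed, is reduced**: it is locally of finite type over `K`, hence Jacobson,
  so the maximal ideals of the coordinate ring `Γ(U)` of an affine open `U` are closed points of
  the fibre, at which the localizations of `Γ(U)` (the stalks) are reduced; reducedness being
  local on maximal ideals (Mathlib `isReduced_ofLocalizationMaximal`) and preserved by
  localization, `Γ(U)` and all stalks are reduced;
* `IsSemiStableCurve.geometricallyReduced` — **a semi-stable curve is geometrically reduced**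
  (Mathlib `GeometricallyReduced`: every base change to a field is reduced): `X ×_S Spec K` is
  dominated by the flat surjective `X ×_S Spec K̄ → X ×_S Spec K` (reducedness descends,
  `DeJong1996.Stage.isReduced_of_flat_surjective` of `AlterationsDescentStage.lean`);
* `IsSemiStableCurve.isReduced_fiber` — the scheme-theoretic fibres `X_s` (Mathlib
  `Scheme.Hom.fiber`) are reduced; `IsSemiStableCurve.isReduced_pullback` — so is every base
  change to a field.

## Sources

* A. J. de Jong, *Smoothness, semi-stability and alterations*, Publ. Math. IHÉS 83 (1996),
  2.21–2.23 (pp. 61–62), 3.4 (p. 63).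
-/

noncomputable section

open CategoryTheory CategoryTheory.Limits AlgebraicGeometry TopologicalSpace IsLocalRing

namespace Literature.AlgebraicGeometry.Resolution

universe u

namespace IsSemiStableCurve

variable {X S : Scheme.{u}} {f : X ⟶ S}

/-- A semi-stable curve is locally of finite type. [folklore] -/
theorem locallyOfFiniteType (h : IsSemiStableCurve f) : LocallyOfFiniteType f :=
  haveI := h.locallyOfFinitePresentation
  inferInstance

/-- **The local rings of a geometric fibre of a semi-stable curve at its closed points are
reduced** (de Jong 1996, 2.21: they are regular of dimension one — domains — or ordinary double
points, whose local rings embed into the reduced `K⟦u, v⟧/(uv)`).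
[cite: DeJong1996, 2.21, p. 61] -/
theorem isReduced_stalk_pullback_of_isClosed (h : IsSemiStableCurve f) (K : Type u) [Field K]
    [IsAlgClosed K] (s : Spec (.of K) ⟶ S) (z : ↥(pullback f s))
    (hz : IsClosed ({z} : Set ↥(pullback f s))) :
    _root_.IsReduced ((pullback f s).presheaf.stalk z) := by
  haveI := h.locallyOfFiniteType
  haveI : IsLocallyNoetherian (pullback f s) :=
    LocallyOfFiniteType.isLocallyNoetherian (pullback.snd f s)
  rcases h.isRegularLocalRing_or_isOrdinaryDoublePoint K s z hz with ⟨hreg, -⟩ | hnode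
  · haveI := isDomain_of_isRegularLocalRing ((pullback f s).presheaf.stalk z : Type u)
    infer_instance
  · exact hnode.isReduced

/-- **A geometric fibre of a semi-stable curve over an algebraically closed field is reduced**
(de Jong 1996, 2.21: "all geometric fibres are connected curves"). The fibre `F = X ×_S Spec K`
is locally of finite type over `K`, hence a Jacobson space; for an affine open `U ⊆ F` and a
maximal ideal `𝔪 ⊂ Γ(F, U)` the corresponding point is closed in `U`, hence in `F`, so
`Γ(F, U)_𝔪 ≅ 𝒪_{F, 𝔪}` is reduced (`isReduced_stalk_pullback_of_isClosed`); reducedness being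
local on the maximal ideals, `Γ(F, U)` is reduced, and so are its localizations, the stalks of
`F`. [cite: DeJong1996, 2.21, p. 61] -/
theorem isReduced_pullback_of_isAlgClosed (h : IsSemiStableCurve f) (K : Type u) [Field K]
    [IsAlgClosed K] (s : Spec (.of K) ⟶ S) : IsReduced (pullback f s) := by
  haveI := h.locallyOfFiniteType
  set F : Scheme.{u} := pullback f s
  haveI : JacobsonSpace F := LocallyOfFiniteType.jacobsonSpace (pullback.snd f s)
  haveI : ∀ p : F, _root_.IsReduced (F.presheaf.stalk p) := fun p => by
    obtain ⟨U, hU, hpU, -⟩ :=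
      exists_isAffineOpen_mem_and_subset (X := F) (x := p) (U := ⊤) trivial
    -- the coordinate ring of `U` is reduced: check at the maximal ideals, i.e. closed points
    have hA : _root_.IsReduced Γ(F, U) := by
      refine isReduced_ofLocalizationMaximal Γ(F, U) fun J hJ => ?_
      let y : PrimeSpectrum Γ(F, U) := ⟨J, hJ.isPrime⟩
      have hyU : hU.fromSpec y ∈ U := hU.range_fromSpec.le ⟨y, rfl⟩
      -- `fromSpec y` is a closed point of `F` (Jacobson)
      have hcl : IsClosed ({hU.fromSpec y} : Set F) := by
        apply isClosed_singleton_of_isLocallyClosed_singleton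
        have h1 : IsClosed ({y} : Set (PrimeSpectrum Γ(F, U))) :=
          (PrimeSpectrum.isClosed_singleton_iff_isMaximal y).mpr hJ
        have h2 := h1.isLocallyClosed.image hU.fromSpec.isOpenEmbedding.isInducing
          hU.fromSpec.isOpenEmbedding.isOpen_range.isLocallyClosed
        rwa [Set.image_singleton] at h2
      have hred := h.isReduced_stalk_pullback_of_isClosed K s _ hcl
      letI : Algebra Γ(F, U) (F.presheaf.stalk (hU.fromSpec y)) :=
        TopCat.Presheaf.algebra_section_stalk F.presheaf ⟨hU.fromSpec y, hyU⟩
      haveI : IsLocalization.AtPrime (F.presheaf.stalk (hU.fromSpec y)) y.asIdeal :=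
        hU.isLocalization_stalk' y hyU
      let e : F.presheaf.stalk (hU.fromSpec y) ≃+* Localization.AtPrime J :=
        (IsLocalization.algEquiv y.asIdeal.primeCompl (F.presheaf.stalk (hU.fromSpec y))
          (Localization.AtPrime y.asIdeal)).toRingEquiv
      exact isReduced_of_injective e.symm.toRingHom e.symm.injective
    -- the stalk at `p` is a localization of `Γ(F, U)`
    letI : Algebra Γ(F, U) (F.presheaf.stalk p) :=
      TopCat.Presheaf.algebra_section_stalk F.presheaf ⟨p, hpU⟩
    haveI : IsLocalization.AtPrime (F.presheaf.stalk p) (hU.primeIdealOf ⟨p, hpU⟩).asIdeal :=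
      hU.isLocalization_stalk ⟨p, hpU⟩
    exact isReduced_localizationPreserves (hU.primeIdealOf ⟨p, hpU⟩).asIdeal.primeCompl _ hA
  exact isReduced_of_isReduced_stalk F

/-- **A semi-stable curve is geometrically reduced** (Mathlib `GeometricallyReduced`: every base
change `X ×_S Spec K` to a field is reduced): the base change to an algebraic closure `K̄` is
reduced (`isReduced_pullback_of_isAlgClosed`) and maps onto `X ×_S Spec K` by the flat surjective
base change of `Spec K̄ → Spec K`, along which reducedness descends
(`DeJong1996.Stage.isReduced_of_flat_surjective`). [cite: DeJong1996, 2.21, p. 61] -/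
theorem geometricallyReduced (h : IsSemiStableCurve f) : GeometricallyReduced f := by
  refine ⟨(geometrically_iff_of_isClosedUnderIsomorphisms (P := (IsReduced ·))).mpr ?_⟩
  intro K _ y
  let Kb : Type u := AlgebraicClosure K
  let ι : Spec (.of Kb) ⟶ Spec (.of K) := Spec.map (CommRingCat.ofHom (algebraMap K Kb))
  haveI : IsReduced (pullback f (ι ≫ y)) := h.isReduced_pullback_of_isAlgClosed Kb (ι ≫ y)
  -- `X ×_S Spec K̄ ≅ (X ×_S Spec K) ×_{Spec K} Spec K̄ → X ×_S Spec K` is flat and surjective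
  haveI : IsReduced (pullback (pullback.snd f y) ι) :=
    isReduced_of_isOpenImmersion (pullbackLeftPullbackSndIso f y ι).hom
  haveI : Surjective ι := by
    dsimp only [ι]
    infer_instance
  haveI : Flat ι := by
    dsimp only [ι]
    infer_instance
  exact DeJong1996.Stage.isReduced_of_flat_surjective (pullback.fst (pullback.snd f y) ι)

/-- The scheme-theoretic fibres `X_s` of a semi-stable curve are reduced.
[cite: DeJong1996, 2.21, p. 61] -/
theorem isReduced_fiber (h : IsSemiStableCurve f) (s : S) : IsReduced (f.fiber s) :=
  haveI := h.geometricallyReduced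
  inferInstance

/-- Every base change of a semi-stable curve to a field is reduced.
[cite: DeJong1996, 2.21, p. 61] -/
theorem isReduced_pullback (h : IsSemiStableCurve f) (K : Type u) [Field K]
    (s : Spec (.of K) ⟶ S) : IsReduced (pullback f s) :=
  pullback_of_geometrically h.geometricallyReduced.geometrically_isReduced K s

end IsSemiStableCurve

end Literature.AlgebraicGeometry.Resolution

end
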